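import Literature.MathematicalPhysics.QuantumLattice.HubbardNNNHoppingInteraction
import Literature.MathematicalPhysics.QuantumLattice.InfVolFermionStateHubbardEnergy
import HarnessLib

/-!
# The mean-energy observable of the `t–t'` Hubbard interaction in a torus: its translates sum
# to `hubbardTorusTT'`

Topic `Literature/MathematicalPhysics/QuantumLattice`. The `t–t'` companion of
`InfVolFermionStateHubbardEnergy.lean` (`sum_relabel_translate_hubbard_meanEnergyObs`: the `L^d`
translates of the pulled-back mean-energy observable of the nearest-neighbour Hubbard interaction
sum to `hubbardTorus d L t U`). Here, for the diagonal hopping interaction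
`diagHoppingFermionInteraction t'` (`HubbardNNNHoppingInteraction.lean`) and `L ≥ 3`:

* `torusDiagGraph_adj_iff`, `proj_diagVec`, `sum_ite_torusDiagGraph_adj` — bookkeeping on the
  diagonal bond graph of the torus `(ℤ/Lℤ)²` (`HubbardNNNHopping.lean`): the four diagonal
  neighbours `x ± (e₁ + e₂)`, `x ± (e₁ − e₂)` are distinct for `L ≥ 3`;
* `fermionEmbed_toTorusEmb_diag_meanEnergyObs` — `Γ(ι) E^{t'}_Φ` is `½ · (−t')` times the four
  diagonal hopping terms through the origin of the torus;
* `sum_relabel_translate_diag_meanEnergyObs` — **the translates of `Γ(ι) E^{t'}_Φ` sum to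
  `hamiltonian (fermionTorusDiagGraph L) t' 0`** (each diagonal bond is shared by its two
  endpoints, weight `½` each);
* `sum_relabel_translate_hubbardTTPrime_meanEnergyObs` — hence the translates of the mean-energy
  observable of the `t–t'` interaction sum to `hubbardTorusTT' L t t' U` (R5.1 of the cell's
  LEAN REQUEST #5: the objective of a reduce-mode certificate for the `t–t'` model).

Bratteli–Robinson II §6.2.4 (mean energy of periodic states); Xu et al. (2024) eq. (1).
Everything is PROVED; no definition, no named fact.
-/

noncomputable section

namespace Literature.MathematicalPhysics.QuantumLattice

open Matrix Finset HubbardWave0 Literature.Probability.LatticeModels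

/-! ### The diagonal bond graph of the torus -/

section DiagGraph

variable {L : ℕ}

/-- Adjacency on the diagonal bond graph of `(ℤ/Lℤ)²`, unfolded: `x ∼ y` iff `x ≠ y` and
`y = x ± (e₁ ± e₂)`. [cite: XuEtAl2024, eq. (1)] -/
theorem torusDiagGraph_adj_iff (x y : TorusSite 2 L) :
    (torusDiagGraph L).Adj x y ↔
      x ≠ y ∧ ((∃ s : Fin 2, y = x + torusDiagJump L s) ∨ ∃ s : Fin 2, x = y + torusDiagJump L s) := by
  rw [torusDiagGraph, SimpleGraph.fromRel_adj]

/-- Adjacency on the fermion-labelled diagonal bond graph is that of the torus sites.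
[cite: XuEtAl2024, eq. (1)] -/
theorem fermionTorusDiagGraph_adj (a b : FermionTorus 2 L) :
    (fermionTorusDiagGraph L).Adj a b ↔ (torusDiagGraph L).Adj a.toTorusSite b.toTorusSite := Iff.rfl

/-- `(e₁ ± e₂) mod L = torusDiagJump L s`. [cite: XuEtAl2024, eq. (1)] -/
theorem proj_diagVec (L : ℕ) (s : Fin 2) : Torus.proj L (diagVec s) = torusDiagJump L s := by
  funext i
  simp only [Torus.proj_apply, diagVec, torusDiagJump]
  split_ifs <;> simp

/-- `(-(e₁ ± e₂)) mod L = -torusDiagJump L s`. [cite: XuEtAl2024, eq. (1)] -/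
theorem proj_neg_diagVec (L : ℕ) (s : Fin 2) : Torus.proj L (-diagVec s) = -torusDiagJump L s := by
  funext i
  simp only [Torus.proj_apply, Pi.neg_apply, diagVec, torusDiagJump]
  split_ifs <;> simp

/-- The first coordinate of a diagonal jump of the torus is `1`. [cite: XuEtAl2024, eq. (1)] -/
@[simp] theorem torusDiagJump_apply_zero (s : Fin 2) : torusDiagJump L s 0 = 1 := by
  simp [torusDiagJump]

/-- The second coordinate of a diagonal jump of the torus is `±1`. [cite: XuEtAl2024, eq. (1)] -/
theorem torusDiagJump_apply_one (s : Fin 2) : torusDiagJump L s 1 = if s = 0 then 1 else -1 := by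
  simp [torusDiagJump]

/-- **Diagonal neighbour sums on the torus, `L ≥ 3`**:
`Σ_{y ∼ x} g(y) = Σ_s (g(x + j_s) + g(x − j_s))` — the four diagonal neighbours of `x` are distinct.
[cite: FriedliVelenik2017, §3.1] -/
theorem sum_ite_torusDiagGraph_adj [NeZero L] {M : Type*} [AddCommMonoid M] (hL : 3 ≤ L)
    (x : TorusSite 2 L) (g : TorusSite 2 L → M) :
    (∑ y, if (torusDiagGraph L).Adj x y then g y else 0) =
      ∑ s : Fin 2, (g (x + torusDiagJump L s) + g (x - torusDiagJump L s)) := by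
  classical
  haveI : Fact (1 < L) := ⟨by omega⟩
  have h1 : (1 : ZMod L) ≠ 0 := one_ne_zero
  have h2 : (1 : ZMod L) + 1 ≠ 0 := by
    intro h
    have : ((2 : ℕ) : ZMod L) = 0 := by exact_mod_cast (by simpa [one_add_one_eq_two] using h)
    rw [ZMod.natCast_eq_zero_iff] at this
    exact absurd (Nat.le_of_dvd two_pos this) (by omega)
  have h11 : (1 : ZMod L) ≠ -1 := fun h => h2 (by linear_combination h)
  -- `j_s ≠ 0`, `j_s + j_{s'} ≠ 0`, `j_s = j_{s'} → s = s'`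
  have hj_ne : ∀ s : Fin 2, torusDiagJump L s ≠ 0 := fun s h => by
    have := congrFun h 0; simp [h1] at this
  have e0 : torusDiagJump L 0 1 = 1 := by simp [torusDiagJump]
  have e1 : torusDiagJump L 1 1 = -1 := by simp [torusDiagJump]
  have hj_inj : ∀ s s' : Fin 2, torusDiagJump L s = torusDiagJump L s' → s = s' := by
    intro s s' h
    have h' := congrFun h 1
    have hs : s = 0 ∨ s = 1 := by fin_cases s <;> simp
    have hs' : s' = 0 ∨ s' = 1 := by fin_cases s' <;> simp
    rcases hs with rfl | rfl <;> rcases hs' with rfl | rfl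
    · rfl
    · rw [e0, e1] at h'; exact absurd h' h11
    · rw [e1, e0] at h'; exact absurd h'.symm h11
    · rfl
  have hsum_ne : ∀ s s' : Fin 2, torusDiagJump L s + torusDiagJump L s' ≠ 0 := by
    intro s s' h
    have := congrFun h 0
    simp [h2] at this
  -- the neighbourhood as a union of two injective images
  set Np : Finset (TorusSite 2 L) := univ.image fun s => x + torusDiagJump L s with hNp
  set Nm : Finset (TorusSite 2 L) := univ.image fun s => x - torusDiagJump L s with hNm
  have hadj : ∀ y, (torusDiagGraph L).Adj x y ↔ y ∈ Np ∪ Nm := by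
    intro y
    rw [torusDiagGraph_adj_iff, Finset.mem_union, Finset.mem_image, Finset.mem_image]
    constructor
    · rintro ⟨-, ⟨s, hs⟩ | ⟨s, hs⟩⟩
      · exact Or.inl ⟨s, mem_univ _, hs.symm⟩
      · exact Or.inr ⟨s, mem_univ _, by rw [hs, add_sub_cancel_right]⟩
    · rintro (⟨s, -, hs⟩ | ⟨s, -, hs⟩)
      · refine ⟨fun hxy => hj_ne s ?_, Or.inl ⟨s, hs.symm⟩⟩
        have := hs; rw [← hxy] at this; simpa using this.symm
      · refine ⟨fun hxy => hj_ne s ?_, Or.inr ⟨s, by rw [← hs, sub_add_cancel]⟩⟩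
        have := hs; rw [← hxy, sub_eq_self] at this; exact this
  have hdisj : Disjoint Np Nm := by
    rw [Finset.disjoint_left]
    intro y hp hm
    rw [hNp, Finset.mem_image] at hp
    rw [hNm, Finset.mem_image] at hm
    obtain ⟨s, -, rfl⟩ := hp
    obtain ⟨s', -, hs'⟩ := hm
    apply hsum_ne s s'
    have := hs'
    rw [sub_eq_iff_eq_add, add_assoc, left_eq_add] at this
    exact this
  have hinjp : Set.InjOn (fun s : Fin 2 => x + torusDiagJump L s) (univ : Finset (Fin 2)) :=
    fun s _ s' _ h => hj_inj s s' (add_left_cancel h)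
  have hinjm : Set.InjOn (fun s : Fin 2 => x - torusDiagJump L s) (univ : Finset (Fin 2)) :=
    fun s _ s' _ h => hj_inj s s' (sub_right_injective h)
  calc (∑ y, if (torusDiagGraph L).Adj x y then g y else 0)
      = ∑ y, if y ∈ Np ∪ Nm then g y else 0 := by
        refine Finset.sum_congr rfl fun y _ => ?_
        simp only [hadj]
    _ = ∑ y ∈ Np ∪ Nm, g y := by rw [Finset.sum_ite_mem, Finset.univ_inter]
    _ = ∑ y ∈ Np, g y + ∑ y ∈ Nm, g y := Finset.sum_union hdisj
    _ = ∑ s, g (x + torusDiagJump L s) + ∑ s, g (x - torusDiagJump L s) := by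
        rw [hNp, hNm, Finset.sum_image hinjp, Finset.sum_image hinjm]
    _ = ∑ s, (g (x + torusDiagJump L s) + g (x - torusDiagJump L s)) := (Finset.sum_add_distrib).symm

end DiagGraph

/-! ### The mean-energy observable of the diagonal interaction pulled back into a torus -/

section TorusImage

variable (t' : ℝ) {L : ℕ} [NeZero L]

/-- **`E^{t'}_Φ` in the torus**: for `x ↦ x mod L` injective on `[-1,1]²`, the second quantisation
`Γ(ι)` maps the mean-energy observable of the diagonal hopping interaction to
`Σ_s ½·(-t') Σ_σ (c†_0 c_{j_s} + c†_{j_s} c_0 + (c†_{-j_s} c_0 + c†_0 c_{-j_s}))`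
(torus sites `ofTorusSite 0`, `ofTorusSite (± torusDiagJump L s)`).
[cite: BratteliRobinsonII1997, §6.2.4] -/
theorem fermionEmbed_toTorusEmb_diag_meanEnergyObs (hT : Set.InjOn (Torus.proj (d := 2) L)
      ↑(thicken ({0} : Finset (Site 2)) 1)) :
    fermionEmbed (PolySite.toTorusEmb L hT) ((diagHoppingFermionInteraction t').meanEnergyObs 1) =
      ∑ s : Fin 2, ((2 : ℂ)⁻¹ * -(t' : ℂ)) • ∑ σ : Fin 2,
        ((creation (orb (FermionTorus.ofTorusSite (0 : TorusSite 2 L)) σ) *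
            annihilation (orb (FermionTorus.ofTorusSite (torusDiagJump L s)) σ) +
          creation (orb (FermionTorus.ofTorusSite (torusDiagJump L s)) σ) *
            annihilation (orb (FermionTorus.ofTorusSite (0 : TorusSite 2 L)) σ)) +
        (creation (orb (FermionTorus.ofTorusSite (-torusDiagJump L s)) σ) *
            annihilation (orb (FermionTorus.ofTorusSite (0 : TorusSite 2 L)) σ) +
          creation (orb (FermionTorus.ofTorusSite (0 : TorusSite 2 L)) σ) *
            annihilation (orb (FermionTorus.ofTorusSite (-torusDiagJump L s)) σ))) := by
  have hproj0 : Torus.proj L (0 : Site 2) = 0 := by funext j; simp [Torus.proj]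
  have hc : ∀ {X : Finset (Site 2)} (hX : X ⊆ thicken ({0} : Finset (Site 2)) 1) (x : Site 2) (hx : x ∈ X)
      (σ : Fin 2),
      fermionEmbed ((PolySite.incl hX).trans (PolySite.toTorusEmb L hT)) (cAt x hx σ) =
        annihilation (orb (FermionTorus.ofTorusSite (Torus.proj L x)) σ) := by
    intro X hX x hx σ
    rw [cAt, fermionEmbed_annihilation]
    rfl
  have hcd : ∀ {X : Finset (Site 2)} (hX : X ⊆ thicken ({0} : Finset (Site 2)) 1) (x : Site 2) (hx : x ∈ X)
      (σ : Fin 2),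
      fermionEmbed ((PolySite.incl hX).trans (PolySite.toTorusEmb L hT)) ((cAt x hx σ)ᴴ) =
        creation (orb (FermionTorus.ofTorusSite (Torus.proj L x)) σ) := by
    intro X hX x hx σ
    rw [cAt, annihilation_conjTranspose, fermionEmbed_creation]
    rfl
  rw [diagHoppingFermionInteraction_meanEnergyObs, fermionEmbed_sum]
  refine Finset.sum_congr rfl fun s _ => ?_
  rw [fermionEmbed_add, fermionEmbed_smul, fermionEmbed_smul, fermionEmbed_fermionEmbed, fermionEmbed_fermionEmbed,
    diagHoppingFermionInteraction_apply_pair, diagHoppingFermionInteraction_apply_pair, fermionEmbed_smul,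
    fermionEmbed_smul, fermionEmbed_sum, fermionEmbed_sum, smul_smul, smul_smul, ← smul_add, ← Finset.sum_add_distrib]
  congr 1
  refine Finset.sum_congr rfl fun σ _ => ?_
  rw [fermionEmbed_add, fermionEmbed_add, fermionEmbed_mul, fermionEmbed_mul, fermionEmbed_mul, fermionEmbed_mul,
    hc, hc, hc, hc, hcd, hcd, hcd, hcd, zero_add, neg_add_cancel, hproj0, proj_diagVec, proj_neg_diagVec]

/-- **The translates of `Γ(ι) E^{t'}_Φ` sum to the diagonal hopping Hamiltonian of the torus.**
For `L ≥ 3`: `Σ_{v ∈ (ℤ/Lℤ)²} T_v (Γ(ι) E^{t'}_Φ) T_v⁻¹ = hamiltonian (fermionTorusDiagGraph L) t' 0`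
(every diagonal bond `{x, x ± j_s}` of the torus is a bond through `v` for exactly its two
endpoints, each with weight `½`). Bratteli–Robinson II §6.2.4 (periodic boundary conditions).
[cite: BratteliRobinsonII1997, §6.2.4] -/
theorem sum_relabel_translate_diag_meanEnergyObs (hL : 3 ≤ L) :
    ∑ v : TorusSite 2 L, relabel (Orb.translate v)
        (fermionEmbed (PolySite.toTorusEmb L (injOn_proj_thicken_one hL))
          ((diagHoppingFermionInteraction t').meanEnergyObs 1)) =
      hamiltonian (fermionTorusDiagGraph L) t' 0 := by
  -- abbreviations for the torus operators
  set o : TorusSite 2 L → FermionTorus 2 L := FermionTorus.ofTorusSite with ho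
  set cd : TorusSite 2 L → Fin 2 → Matrix (Finset (Orb (FermionTorus 2 L))) (Finset (Orb (FermionTorus 2 L))) ℂ :=
    fun x σ => creation (orb (o x) σ) with hcd
  set c : TorusSite 2 L → Fin 2 → Matrix (Finset (Orb (FermionTorus 2 L))) (Finset (Orb (FermionTorus 2 L))) ℂ :=
    fun x σ => annihilation (orb (o x) σ) with hc
  -- the translate by `v` of `Γ(ι) E_Φ`
  have hcomm : ∀ (w : TorusSite 2 L) (s : Fin 2), torusDiagJump L s + w = w + torusDiagJump L s :=
    fun w s => add_comm _ _
  have htrans : ∀ v : TorusSite 2 L, relabel (Orb.translate v)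
      (fermionEmbed (PolySite.toTorusEmb L (injOn_proj_thicken_one hL))
        ((diagHoppingFermionInteraction t').meanEnergyObs 1)) =
      ∑ s : Fin 2, ((2 : ℂ)⁻¹ * -(t' : ℂ)) • ∑ σ : Fin 2,
        ((cd v σ * c (v + torusDiagJump L s) σ + cd (v + torusDiagJump L s) σ * c v σ) +
          (cd (v - torusDiagJump L s) σ * c v σ + cd v σ * c (v - torusDiagJump L s) σ)) := by
    intro v
    rw [fermionEmbed_toTorusEmb_diag_meanEnergyObs t' (injOn_proj_thicken_one hL), relabel_sum]
    simp only [relabel_smul, relabel_sum, relabel_add, relabel_mul, relabel_creation, relabel_annihilation,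
      Orb.translate_orb, zero_add, neg_add_eq_sub, hcomm]
    rfl
  simp_rw [htrans]
  rw [Finset.sum_comm]
  -- the Hamiltonian, with all sums over `TorusSite`
  have hH : hamiltonian (fermionTorusDiagGraph L) t' 0 =
      -(t' : ℂ) • (∑ v : TorusSite 2 L, ∑ s : Fin 2, ∑ σ : Fin 2,
          (cd v σ * c (v + torusDiagJump L s) σ + cd v σ * c (v - torusDiagJump L s) σ)) := by
    rw [hamiltonian, Complex.ofReal_zero, zero_smul, add_zero]
    congr 1
    rw [← Fintype.sum_equiv FermionTorus.equivTorusSite.symm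
      (fun v : TorusSite 2 L => ∑ s : Fin 2, ∑ σ : Fin 2,
        (cd v σ * c (v + torusDiagJump L s) σ + cd v σ * c (v - torusDiagJump L s) σ)) _ (fun v => ?_)]
    rw [← Fintype.sum_equiv FermionTorus.equivTorusSite.symm
      (fun w : TorusSite 2 L => ∑ σ : Fin 2,
        if (fermionTorusDiagGraph L).Adj (FermionTorus.equivTorusSite.symm v) (o w) then
          creation (orb (FermionTorus.equivTorusSite.symm v) σ) * annihilation (orb (o w) σ) else 0)
      _ (fun w => rfl)]
    have hv : (FermionTorus.equivTorusSite.symm v : FermionTorus 2 L) = o v := rfl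
    simp_rw [hv]
    have hadj : ∀ w : TorusSite 2 L, (fermionTorusDiagGraph L).Adj (o v) (o w) ↔ (torusDiagGraph L).Adj v w := by
      intro w; rw [fermionTorusDiagGraph_adj, ho, FermionTorus.toTorusSite_ofTorusSite, FermionTorus.toTorusSite_ofTorusSite]
    have hite : ∀ w : TorusSite 2 L, (∑ σ : Fin 2,
        if (fermionTorusDiagGraph L).Adj (o v) (o w) then creation (orb (o v) σ) * annihilation (orb (o w) σ) else 0) =
        if (torusDiagGraph L).Adj v w then ∑ σ : Fin 2, cd v σ * c w σ else 0 := by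
      intro w
      by_cases h : (torusDiagGraph L).Adj v w
      · rw [if_pos h]
        exact Finset.sum_congr rfl fun σ _ => by rw [if_pos ((hadj _).2 h)]
      · rw [if_neg h]
        exact Finset.sum_eq_zero fun σ _ => by rw [if_neg (fun h' => h ((hadj _).1 h'))]
    simp_rw [hite]
    rw [sum_ite_torusDiagGraph_adj hL v]
    simp only [Finset.sum_add_distrib]
  rw [hH]
  -- the hopping part: each bond is counted twice with weight ½
  simp only [Finset.smul_sum]
  conv_rhs => rw [Finset.sum_comm]
  refine Finset.sum_congr rfl fun s _ => ?_
  have hshift1 : ∑ v : TorusSite 2 L, ∑ σ : Fin 2, ((2 : ℂ)⁻¹ * -(t' : ℂ)) • (cd (v + torusDiagJump L s) σ * c v σ) =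
      ∑ v : TorusSite 2 L, ∑ σ : Fin 2, ((2 : ℂ)⁻¹ * -(t' : ℂ)) • (cd v σ * c (v - torusDiagJump L s) σ) :=
    (TorusSite.sum_sub_shift (torusDiagJump L s)
      (fun a b => ∑ σ : Fin 2, ((2 : ℂ)⁻¹ * -(t' : ℂ)) • (cd a σ * c b σ))).symm
  have hshift2 : ∑ v : TorusSite 2 L, ∑ σ : Fin 2, ((2 : ℂ)⁻¹ * -(t' : ℂ)) • (cd (v - torusDiagJump L s) σ * c v σ) =
      ∑ v : TorusSite 2 L, ∑ σ : Fin 2, ((2 : ℂ)⁻¹ * -(t' : ℂ)) • (cd v σ * c (v + torusDiagJump L s) σ) :=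
    TorusSite.sum_sub_shift (torusDiagJump L s)
      (fun a b => ∑ σ : Fin 2, ((2 : ℂ)⁻¹ * -(t' : ℂ)) • (cd b σ * c a σ))
  simp only [smul_add, Finset.sum_add_distrib]
  rw [hshift1, hshift2]
  have ha : ((2 : ℂ)⁻¹ * -(t' : ℂ)) + ((2 : ℂ)⁻¹ * -(t' : ℂ)) = -(t' : ℂ) := by ring
  simp only [← Finset.smul_sum]
  conv_rhs => rw [← ha, add_smul, add_smul]
  abel

/-- **The translates of the mean-energy observable of the `t–t'` interaction sum to the `t–t'`
torus Hamiltonian**: for `L ≥ 3`,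
`Σ_{v ∈ (ℤ/Lℤ)²} T_v (Γ(ι) E^{tt'}_Φ) T_v⁻¹ = hubbardTorusTT' L t t' U` — the objective of a
reduce-mode (window) certificate for the `t–t'` Hubbard model (Han 2020 §3) is the energy per site
of `hubbardTorusTT'`. [cite: BratteliRobinsonII1997, §6.2.4] -/
theorem sum_relabel_translate_hubbardTTPrime_meanEnergyObs (t U : ℝ) (hL : 3 ≤ L) :
    ∑ v : TorusSite 2 L, relabel (Orb.translate v)
        (fermionEmbed (PolySite.toTorusEmb L (injOn_proj_thicken_one hL))
          ((hubbardTTPrimeFermionInteraction t t' U).meanEnergyObs 1)) =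
      hubbardTorusTT' L t t' U := by
  simp_rw [hubbardTTPrimeFermionInteraction_meanEnergyObs, fermionEmbed_add, relabel_add, Finset.sum_add_distrib,
    sum_relabel_translate_hubbard_meanEnergyObs t U hL, sum_relabel_translate_diag_meanEnergyObs t' hL]
  rfl

end TorusImage

end Literature.MathematicalPhysics.QuantumLattice

end
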